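import Literature.AlgebraicGeometry.Deformation.CoefficientFieldOfArtinLocal
import HarnessLib

/-!
# FLOOR-0 P1, sub-line F-11, grandchild line `F11LiftWithLineBundle` — STUB G0 CLOSED: every Artinian local `ℚ`-algebra has a coefficient field

Cell hodgecm-mathlib (D-0151), FLOOR 0, crux item HDel = stmt-HodgeConjecture-24835; grandchild line `F0/P1b/Lines/F11LiftWithLineBundle`
(line v0 b62f088b8d1fd074, F0P1b-plan (g0); parent `Cruxes/HDel/Lines/F11SmoothRoadA.lean`, stub α1 `stub_liftWithLineBundle`), registered
stub **G0 `stub_coefficientField`**.  PROOF lane; author F0P1b-p04 (g0) (JOIN BRIEF v0 job J1 (CF)).  This file proves the stub's TYPE restated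
BINDER FOR BINDER (token-identically to the body of `…Cruxes.HypDel.F11LiftWithLineBundle.stub_coefficientField`; the Lines module is not
imported — crux workfiles are not built on the farm, director s347 closer protocol), so that the line's next edition closes the hole BY NAME:
`theorem stub_coefficientField : … := F11StubG0CoefficientField.stubG0_holds`.

Content: for `A` Artinian local with `Algebra ℚ A`, the residue field `k := A⧸𝔪_A` itself is a coefficient field: ★
`Literature.AlgebraicGeometry.Deformation.exists_algebra_residueField_section (K := ℚ)` gives an `Algebra k A` structure with
`residue ∘ algebraMap k A = id` (Cohen's structure theorem, equicharacteristic `0`, nilpotent case — ★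
`RingTheory.Smooth.exists_section_residue_of_formallySmooth` + ★ `Resolution.formallySmooth_of_charZero`), and a map with a left inverse
`id` is surjective.  No hypothesis on `k/ℚ` (transcendental residue fields allowed).

HC_CM is proved only modulo the 7 printed citations until rung 0 closes; this closes ONE of the three stubs (G0; G1, G2 open) of ONE grandchild line.

## References
* [Lan2013PELCompactifications] K.-W. Lan, *Arithmetic compactifications of PEL-type Shimura varieties* (2013): App. B.1.1, Def. B.1.1.1 and
  Thm. B.1.1.2 (p. 586).
* [Matsumura1987] H. Matsumura, *Commutative Ring Theory*: Thm. 28.3 (ii) (p. 215).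
-/

set_option autoImplicit false
set_option linter.dupNamespace false

noncomputable section

namespace Summit.HodgeConjecture.HodgeConjecture.Cruxes.HDel.F11StubG0CoefficientField

open IsLocalRing

/-- **STUB G0 of line `F11LiftWithLineBundle`, proved** — the body of `stub_coefficientField` binder for binder: an Artinian local `ℚ`-algebra
`A` has a field `k` and an `Algebra k A` structure with `residue ∘ algebraMap k A` SURJECTIVE; witness `k := ResidueField A` with the
coefficient-field structure of ★ `exists_algebra_residueField_section` (`residue ∘ algebraMap = id`).
[cite: Lan2013PELCompactifications, Def. B.1.1.1 and Thm. B.1.1.2 (p. 586)] [cite: Matsumura1987, Thm. 28.3 (ii) (p. 215)] -/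
theorem stubG0_holds :
    ∀ (A : Type) [CommRing A] [Algebra ℚ A] [IsArtinianRing A] [IsLocalRing A],
      ∃ (k : Type) (_ : Field k) (_ : Algebra k A), Function.Surjective (⇑(IsLocalRing.residue A) ∘ ⇑(algebraMap k A)) := by
  intro A _ _ _ _
  obtain ⟨inst, -, hsec⟩ :=
    Literature.AlgebraicGeometry.Deformation.exists_algebra_residueField_section (K := ℚ) (A := A)
  refine ⟨ResidueField A, inferInstance, inst, fun x => ⟨x, ?_⟩⟩
  exact congr($hsec x)

end Summit.HodgeConjecture.HodgeConjecture.Cruxes.HDel.F11StubG0CoefficientField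

end
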